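import Summits.AnomalousDissipation.AnomalousDissipation.Theses.SolenoidalFractalHomogenisation
import Summits.AnomalousDissipation.AnomalousDissipation.Theorems.SolenoidalFractalHomogenisationLagrangianCarrierConstructionBookkeepingL
import Summits.AnomalousDissipation.AnomalousDissipation.Theorems.SolenoidalFractalHomogenisationLagrangianCarrierConstructionStubFlowsL
import Summits.AnomalousDissipation.AnomalousDissipation.Theorems.SolenoidalFractalHomogenisationLagrangianCarrierConstructionStubRegularL
import HarnessLib

/-!
# K3L `LagrangianCarrierConstruction` (stmt-AnomalousDissipation-24913), line `birth`: the by-name closer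

Summits-side file (everything proved; no definitions, no named facts). The kernel-checked composition of the registered skeleton r23 v8 of line
`birth` (sha16 8d571f7a60077c12, `ledger skeleton check` registry of stmt-AnomalousDissipation-24913) with its three registered stubs fed by the
LANDED theorems: `stub_bookkeepingL` (p611052, `…BookkeepingL`: the super-geometric bookkeeping family realising `Permissible` + (W1) (W2) (S) +
the template (T1)–(T5) + amplitude decay, for EVERY `θ₀ > 0`), `stub_flowsL` (p622977, `…StubFlowsL`: the Lagrangian insertion exists with
`IsLagrangian` and the eleven qualitative clauses of `LevelRegular`), `stub_regularL` (`…StubRegularL`: `Regular` of the summed carrier under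
the strain-budget ceiling `θ₀ ≤ θs(k, W)` — distortion tower). Composition (the registered v8 glue `LagrangianCarrierConstruction_of_hyps`,
inlined with the stubs fed by name): the regularity stub fixes `θs`; the bookkeeping is built at `min θ₀ θs` (its (T4) clause is monotone in `θ₀`, so the crux's
clause for `θ₀` and the stub's for `θs` both follow); the witness is the inserted carrier over that bookkeeping. The theorem's type is LITERALLY
the route decl `Summit.AnomalousDissipation.AnomalousDissipation.Theses.SolenoidalFractalHomogenisation.LagrangianCarrierConstruction`.
WHAT THIS IS: the construction + regularity of the route's Lagrangian lattice carrier (crux K3L of route-1 `SolenoidalFractalHomogenisation`),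
infrastructure for the rung leaf F-D1.A0 — a FRONTIER FORMAL rung. WHAT IT IS NOT: anomalous dissipation (NOT claimed), nor the route's target
(K1L `LagrangianRenormalisationStep`, stmt-AnomalousDissipation-24912, remains open).
[cite: ArmstrongVicol2025, §2.2 (PDF pp. 12, 16, 18), Thm. 1.1 (regularity class), Prop. 2.2 / Cor. 2.4 (pp. 19–22), §5.1]
-/

set_option linter.dupNamespace false

noncomputable section

namespace Summit.AnomalousDissipation.AnomalousDissipation.Theorems.SolenoidalFractalHomogenisation.LagrangianCarrierConstruction

open Summit.AnomalousDissipation.AnomalousDissipation.Theses.SolenoidalFractalHomogenisation (LagrangianCarrierConstruction)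

/-- **K3L `LagrangianCarrierConstruction` from the three landed stubs of line `birth`** (`stub_bookkeepingL` p611052, `stub_flowsL` p622977,
`stub_regularL` p631999), composed by the registered v8 glue (verbatim, with the stubs fed by name): the regularity stub fixes `θs`; the
bookkeeping is built at `min θ₀ θs`; the witness is the inserted carrier over that bookkeeping.
[cite: ArmstrongVicol2025, §2.2 (PDF pp. 12, 18), Thm. 1.1, Prop. 2.2 (p. 19), §5.1] -/
theorem LagrangianCarrierConstruction_of : LagrangianCarrierConstruction := by
  have h₁ := @stub_bookkeepingL
  have h₂ := @stub_flowsL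
  have h₃ := @stub_regularL
  intro k W c ν₀ K θ₀ Λ₀ hc hν₀ hK hθ₀
  -- v8: the regularity stub fixes a strain-budget ceiling `θs = θs(k, W) > 0`; the bookkeeping is built for `min θ₀ θs`
  -- (its template clause (T4) is monotone in `θ₀`, so the crux's clause for `θ₀` and the stub's for `θs` both follow).
  obtain ⟨θs, hθs, h₃'⟩ := h₃ k W
  obtain ⟨E, hD, hg, hn, hKK, hP, hW1, hW2, hS, t1a, t1b, t2, t3, t4, t5, hdec⟩ :=
    h₁ k W c ν₀ K (min θ₀ θs) Λ₀ hc hν₀ hK (lt_min hθ₀ hθs)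
  obtain ⟨E', hF, hr, hθ, hLag, l1, l2, l3a, l3b, l4, f1a, f1b, f1c, f2a, f2b, f2c⟩ := h₂ k E hP hW1 hW2
  obtain ⟨F', refresh', θ', b', disp', hrp', hθp'⟩ := E'
  obtain ⟨F, refresh, θ, b, disp, hrp, hθp⟩ := E
  simp only at hF hr hθ
  subst hF hr hθ
  -- the witness is E' (fields b', disp'); every bookkeeping clause of E transports by definitional unfolding of the projections
  refine ⟨⟨F', refresh', θ', b', disp', hrp', hθp'⟩, hD, hg, hn, hKK,
    Literature.Analysis.FluidPDE.LatticeShear.LagrangianLatticeCarrier.LPermissible.intro hP hLag hW1 hW2 hS hdec,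
    h₃' ⟨F', refresh', θ', b', disp', hrp', hθp'⟩ (min θ₀ θs) hD (min_le_right _ _) hP hLag l1 l2 l3a l3b l4 f1a f1b f1c f2a f2b f2c hW1 hW2 hS t1b t4 hdec, t1a, t1b, t2, t3,
    fun m => (t4 m).trans (min_le_left _ _), t5⟩

end Summit.AnomalousDissipation.AnomalousDissipation.Theorems.SolenoidalFractalHomogenisation.LagrangianCarrierConstruction

end
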